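import Literature.AlgebraicGeometry.Modules.SerreTwistHyperplaneClass
import Literature.AlgebraicGeometry.Motives.NormMapInvariantMorphism
import HarnessLib

/-!
# The Čech class of the cocycle of a covering family of FORMS of degree `e` is the class of `𝒪_Y(e²)`

Layer `Literature/AlgebraicGeometry/Modules`, namespace `Literature.AlgebraicGeometry.Modules.SerreTwist`.  THEOREMS ONLY (no definition,
no named fact, no instance, no notation, no `sorry`).  Cell `hodgecm-mathlib` (D-0151), F-DAG F-9 row 7 bridge (Bz) (cut to B-p11 (g18)
by the (M2) author B-p10 (g12), STATUS 11:37:34Z; consumer: (M2d) step 6/7 of `B-provers/B-p10/g12/RECIPE-M2d-hF9-assembly.B-p10g12.md`,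
the cocycle `cY` of ★-soon (M2c) `FramedPieces.exists_lineBundle_sections_of_forms`).  Count-neutral capital: HC_CM is proved only modulo
the 7 printed citations until rung 0 closes — nothing here bears on a summit statement.

For `φ : Y → 𝐏ʳ_A` and forms `F_c ∈ A[x₀,…,x_r]_e` whose loci `φ⁻¹D₊(F_c)` cover `Y`, (M2c) glues a line bundle from the cocycle with
opens `U_y = φ⁻¹D₊(F_{i y})` and transition functions `g_{yy'} = φ^*((F_{i y'}/F_{i y})^e)` (★ `GeneratingSections.formHomRatio`; note
Mathlib's `Away.isLocalizationElem h_F h_G = G^e/F^e` for forms of degree `e`, so the transition functions are `e`-TH POWERS of the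
degree-`0` ratios `F_{i y'}/F_{i y}`).  This file identifies its class in `Ȟ¹(Y, 𝒪_Y^×)`: it is the class of `𝒪_Y(e·e)`, i.e. the
INVERSE of the determinant class of the Serre twist `serreTwist φ (e * e) = 𝒪_Y(-e²)` (★ `Modules/SerreTwist`, ★ `transitionDet_chartFrame`:
chart frames with transition functions `(x_j/x_{j'})^{e²}`), via the explicit coboundary `λ_y = φ^*(F_{i y}^e / x_{j y}^{e²})` on
`φ⁻¹(D₊(F_{i y}) ∩ D₊(x_{j y}))` — [Hartshorne1977] II Prop. 5.12 (b) («`𝒪(n)` is glued by `(x_i/x_j)^n`») with II Ex. 5.16 (d) / III Ex. 4.5.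

* §1 `res_appLE_awayToSection` — bookkeeping: a section `φ^*(a)`, `a ∈ A_{(f)}`, restricted to an open below `φ⁻¹D₊(f·g)` is `φ^*` of
  `a` read in `A_{(f g)}` (Mathlib `awayMap_awayToSection`).
* §2 **`cechPic_mk_eq_inv_detClass_serreTwist_of_forms`** — for ANY cocycle `cY` and chart choice `i` satisfying the two characterising
  clauses of (M2c) (`hU`, `hg`): `CechPic.mk cY = (detClass (isFiniteLocallyFree_serreTwist φ (e * e)))⁻¹`.

## References
* [Hartshorne1977] R. Hartshorne, *Algebraic Geometry* (1977), II Prop. 5.12 (p. 117); II Ex. 5.16 (d); III Ex. 4.5; II Prop. 2.5 (b).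
* [GortzWedhorn2020] U. Görtz, T. Wedhorn, *Algebraic Geometry I: Schemes*, 2nd ed. (2020), Section (13.8) and Prop. 11.21 (p. 302).
-/

noncomputable section

-- `TopCat.Presheaf`/`Scheme.Modules` are not reducible (as in Mathlib's `AlgebraicGeometry/Modules/Sheaf.lean`).
set_option backward.isDefEq.respectTransparency false

universe u

open CategoryTheory AlgebraicGeometry TopologicalSpace Opposite HomogeneousLocalization
open Literature.AlgebraicGeometry.Morphisms Literature.AlgebraicGeometry.Morphisms.ProjCech
open Literature.AlgebraicGeometry.Motives Literature.AlgebraicGeometry.Motives.Segre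

-- Mathlib keeps `MvPolynomial.gradedAlgebra` a `def`; made an instance locally as in the tree's `Proj A[x₀,…,x_r]` files
-- (e.g. ★ `Modules/SerreTwistHyperplaneClass`, ★ `Motives/GeneratingSectionsOfHomAppLE`).
attribute [local instance] MvPolynomial.gradedAlgebra

namespace Literature.AlgebraicGeometry.Modules

namespace SerreTwist

variable {A : Type u} [CommRing A] {r : ℕ} {Y : Scheme.{u}} (φ : Y ⟶ PP A r)

/-! ## §1 Restricting `φ^*` of a section over `D₊(f)` to an open below `φ⁻¹D₊(f g)` -/

/-- **`φ^*(a)|_V = φ^*(a|_{D₊(fg)})|_V`** for `a ∈ A_{(f)}` and `V ⊆ φ⁻¹D₊(f g)`: the section `awayToSection f a` restricted to `D₊(f g)` is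
`awayToSection (f g) (awayMap a)` (Mathlib `awayMap_awayToSection`), and `φ.appLE` is natural in both opens.
[cite: Hartshorne1977, II Prop. 2.5 (b)] -/
theorem res_appLE_awayToSection {f g x : MvPolynomial (Fin (r + 1)) A} {m' : ℕ} (g_deg : g ∈ grading A r m')
    (hx : x = f * g) (a : Away (grading A r) f) {U V : Y.Opens} (hU : U ≤ φ ⁻¹ᵁ Proj.basicOpen (grading A r) f)
    (hVU : V ≤ U) (hV : V ≤ φ ⁻¹ᵁ Proj.basicOpen (grading A r) x) :
    Y.presheaf.map (homOfLE hVU).op (φ.appLE (Proj.basicOpen (grading A r) f) U hU (Proj.awayToSection (grading A r) f a)) =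
      φ.appLE (Proj.basicOpen (grading A r) x) V hV (Proj.awayToSection (grading A r) x (awayMap (grading A r) g_deg hx a)) := by
  have h1 : Proj.awayToSection (grading A r) x (awayMap (grading A r) g_deg hx a) =
      (Proj (grading A r)).presheaf.map (homOfLE (Proj.basicOpen_mono _ _ _ ⟨_, hx⟩)).op
        (Proj.awayToSection (grading A r) f a) := by
    have h := congrArg (fun ψ : CommRingCat.of (Away (grading A r) f) ⟶ _ => ψ.hom a)
      (Proj.awayMap_awayToSection (grading A r) (f := f) g_deg hx)
    simpa only [CommRingCat.hom_comp, RingHom.coe_comp, Function.comp_apply, CommRingCat.hom_ofHom] using h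
  rw [h1]
  have hL := congrArg (fun ψ : Γ(PP A r, Proj.basicOpen (grading A r) f) ⟶ Γ(Y, V) =>
    ψ.hom (Proj.awayToSection (grading A r) f a)) (Scheme.Hom.appLE_map φ hU (homOfLE hVU).op)
  have hR := congrArg (fun ψ : Γ(PP A r, Proj.basicOpen (grading A r) f) ⟶ Γ(Y, V) =>
    ψ.hom (Proj.awayToSection (grading A r) f a))
    (Scheme.Hom.map_appLE φ hV (homOfLE (Proj.basicOpen_mono _ _ _ ⟨_, hx⟩)).op)
  simp only [CommRingCat.hom_comp, RingHom.comp_apply] at hL hR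
  exact hL.trans hR.symm

/-! ## §2 The class of the cocycle of forms -/

/-- **THE ČECH CLASS OF THE FORM COCYCLE IS `[𝒪_Y(e²)] = [𝒪_Y(-e²)]⁻¹`.**  For `φ : Y → 𝐏ʳ_A`, forms `F_c` of degree `e > 0`, and ANY
unit cocycle `cY` with chart choice `i : Y → κ` whose opens are `φ⁻¹D₊(F_{i y})` (`hU`) and whose transition functions are the pulled-back
ratios `φ^*((F_{i y'}/F_{i y})^e)` (`hg`, ★ `GeneratingSections.formHomRatio`) — the output shape of (M2c)
`FramedPieces.exists_lineBundle_sections_of_forms` —: `CechPic.mk cY = (detClass 𝒪_Y(-e·e))⁻¹`.  Proof: the chart frame system of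
`serreTwist φ (e*e)` at `j y` with `y ∈ φ⁻¹D₊(x_{j y})` has cocycle `φ^*((x_{j y}/x_{j y'})^{e²})` (★ `transitionDet_chartFrame`,
★ `map_homRatio_eq_map_chartFun`, ★ `homRatio_eq_appLE`); on `φ⁻¹(D₊(F_{i y}) ∩ D₊(x_{j y}))` the unit `λ_y = φ^*(F_{i y}^e/x_{j y}^{e²})`
satisfies `φ^*((x_{j y'}/x_{j y})^{e²}) · λ_{y'} = λ_y · φ^*((F_{i y'}/F_{i y})^e)` — an identity of fractions over `D₊(x_{j y} x_{j y'} F_{i y} F_{i y'})`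
(§1), checked in the localisation.
[cite: Hartshorne1977, II Prop. 5.12 (p. 117)] [cite: Hartshorne1977, III Ex. 4.5] [cite: GortzWedhorn2020, Prop. 11.21 (p. 302)] -/
theorem cechPic_mk_eq_inv_detClass_serreTwist_of_forms {κ : Type} (F : κ → MvPolynomial (Fin (r + 1)) A) {e : ℕ}
    (hF : ∀ c, F c ∈ grading A r e) (he : 0 < e) (cY : UnitCocycle Y) (i : Y → κ)
    (hU : ∀ y, cY.U y = φ ⁻¹ᵁ Proj.basicOpen (grading A r) (F (i y)))
    (hg : ∀ (y y' : Y) (V : Y.Opens) (hy : V ≤ cY.U y) (hy' : V ≤ cY.U y'),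
      cY.g y y' V hy hy' = secRes Y (hy.trans (hU y).le) (GeneratingSections.formHomRatio φ F hF he (i y) (i y'))) :
    CechPic.mk cY = (detClass (isFiniteLocallyFree_serreTwist φ (e * e)))⁻¹ := by
  classical
  -- a chart choice `y ∈ φ⁻¹D₊(x_{j y})`
  have hcovZ : ∀ y : Y, ∃ j : Fin (r + 1), y ∈ Zop φ {j} := fun y => by
    have hy : y ∈ (⊤ : Y.Opens) := trivial
    rw [← iSup_cover_eq_top φ] at hy
    exact Opens.mem_iSup.mp hy
  choose j hj using hcovZ
  -- the chart frame system of `𝒪_Y(-e²)`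
  let G : FrameSystem (serreTwist φ (e * e)) :=
    { U := fun y => Zop φ {j y}
      mem := hj
      I := fun _ => PUnit.{u + 1}
      rank := fun _ => 1
      enum := fun _ => _root_.Equiv.ofUnique PUnit (Fin 1)
      frame := fun y => freePUnitIso (Zop φ {j y}) ≪≫ (overIsoUnit φ (e * e) (j y)).symm }
  have hGg : ∀ (y y' : Y) (V : Y.Opens) (hy : V ≤ Zop φ {j y}) (hy' : V ≤ Zop φ {j y'}),
      G.cocycle.g y y' V hy hy' = Y.presheaf.map (homOfLE hy').op (chartFun φ (j y) (j y')) ^ (e * e) :=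
    fun y y' V hy hy' => transitionDet_chartFrame φ (e * e) (j y) (j y') hy hy'
  rw [detClass_eq_mk _ G, ← CechPic.mk_inv]
  apply CechPic.sound
  -- degrees and the common denominators
  have hXdeg : ∀ a : Fin (r + 1), (MvPolynomial.X a : MvPolynomial (Fin (r + 1)) A) ∈ grading A r 1 := X_mem A
  have hFe : ∀ y, F (i y) ^ e ∈ grading A r ((e * e) • 1) := fun y => by
    rw [smul_eq_mul, mul_one]; exact SetLike.pow_mem_graded e (hF (i y))
  have hXee : ∀ y, (MvPolynomial.X (j y) : MvPolynomial (Fin (r + 1)) A) ^ (e * e) ∈ grading A r (e • e) := fun y => by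
    have h := SetLike.pow_mem_graded (e * e) (hXdeg (j y))
    rw [smul_eq_mul, mul_one] at h
    rw [smul_eq_mul]
    exact h
  -- `Z_{j y} = φ⁻¹D₊(x_{j y})`
  have hZop : ∀ y, Zop φ {j y} = φ ⁻¹ᵁ Proj.basicOpen (grading A r) (MvPolynomial.X (j y)) := fun y => by
    rw [Zop_singleton_eq_preU]
  -- the units `λ_y = φ^*(F_{i y}^e / x_{j y}^{e²})` on `Z_{j y}` and their inverses `μ_y = φ^*(x_{j y}^{e²}/F_{i y}^e)` on `U_y`
  let lam : ∀ y, Γ(Y, Zop φ {j y}) := fun y =>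
    φ.appLE (Proj.basicOpen (grading A r) (MvPolynomial.X (j y))) (Zop φ {j y}) (hZop y).le
      (Proj.awayToSection (grading A r) (MvPolynomial.X (j y)) (Away.mk (grading A r) (hXdeg (j y)) (e * e) (F (i y) ^ e) (hFe y)))
  let mu : ∀ y, Γ(Y, cY.U y) := fun y =>
    φ.appLE (Proj.basicOpen (grading A r) (F (i y))) (cY.U y) (hU y).le
      (Proj.awayToSection (grading A r) (F (i y)) (Away.mk (grading A r) (hF (i y)) e (MvPolynomial.X (j y) ^ (e * e)) (hXee y)))
  refine ⟨{ W := fun y => cY.U y ⊓ Zop φ {j y}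
            mem := fun y => ⟨cY.mem y, hj y⟩
            le := fun y => inf_le_left
            le' := fun y => inf_le_right
            lam := fun y V hV => secRes Y (hV.trans inf_le_right) (lam y)
            inv := fun y V hV => secRes Y (hV.trans inf_le_left) (mu y)
            map_lam := fun y V V' hV h => by rw [secRes_secRes]
            lam_mul_inv := fun y V hV => ?_
            rel := fun y y' V hy hy' => ?_ }⟩
  · -- `λ_y μ_y = 1` on `V ⊆ φ⁻¹D₊(F_{i y} x_{j y})`
    have hVF : V ≤ φ ⁻¹ᵁ Proj.basicOpen (grading A r) (F (i y)) := (hV.trans inf_le_left).trans (hU y).le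
    have hVX : V ≤ φ ⁻¹ᵁ Proj.basicOpen (grading A r) (MvPolynomial.X (j y)) := (hV.trans inf_le_right).trans (hZop y).le
    have hVP : V ≤ φ ⁻¹ᵁ Proj.basicOpen (grading A r) (MvPolynomial.X (j y) * F (i y)) := by
      rw [Proj.basicOpen_mul, Scheme.Hom.preimage_inf]; exact le_inf hVX hVF
    have hprod : awayMap (grading A r) (hF (i y)) rfl
          (Away.mk (grading A r) (hXdeg (j y)) (e * e) (F (i y) ^ e) (hFe y)) *
        awayMap (grading A r) (hXdeg (j y)) (mul_comm _ _)
          (Away.mk (grading A r) (hF (i y)) e (MvPolynomial.X (j y) ^ (e * e)) (hXee y)) = 1 := by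
      apply val_injective
      simp only [val_mul, val_one, awayMap_mk, Away.val_mk, Localization.mk_mul, ← Localization.mk_one]
      rw [Localization.mk_eq_mk_iff, Localization.r_iff_exists]
      exact ⟨1, by simp only [OneMemClass.coe_one, Submonoid.coe_mul, one_mul, mul_one]; ring⟩
    change secRes Y _ (lam y) * secRes Y _ (mu y) = 1
    rw [secRes, secRes, res_appLE_awayToSection φ (hF (i y)) rfl _ (hZop y).le (hV.trans inf_le_right) hVP,
      res_appLE_awayToSection φ (hXdeg (j y)) (mul_comm _ _) _ (hU y).le (hV.trans inf_le_left) hVP, ← map_mul, ← map_mul,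
      hprod, map_one, map_one]
  · -- the coboundary relation `(x_{j y'}/x_{j y})^{e²} · λ_{y'} = λ_y · (F_{i y'}/F_{i y})^e` on `V`
    have hVF : V ≤ φ ⁻¹ᵁ Proj.basicOpen (grading A r) (F (i y)) := (hy.trans inf_le_left).trans (hU y).le
    have hVX : V ≤ φ ⁻¹ᵁ Proj.basicOpen (grading A r) (MvPolynomial.X (j y)) := (hy.trans inf_le_right).trans (hZop y).le
    have hVF' : V ≤ φ ⁻¹ᵁ Proj.basicOpen (grading A r) (F (i y')) := (hy'.trans inf_le_left).trans (hU y').le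
    have hVX' : V ≤ φ ⁻¹ᵁ Proj.basicOpen (grading A r) (MvPolynomial.X (j y')) := (hy'.trans inf_le_right).trans (hZop y').le
    -- the common denominator `P = x_{j y} · x_{j y'} · F_{i y} · F_{i y'}`
    have hVP : V ≤ φ ⁻¹ᵁ Proj.basicOpen (grading A r)
        (MvPolynomial.X (j y) * (MvPolynomial.X (j y') * (F (i y) * F (i y')))) := by
      rw [Proj.basicOpen_mul, Proj.basicOpen_mul, Proj.basicOpen_mul, Scheme.Hom.preimage_inf, Scheme.Hom.preimage_inf,
        Scheme.Hom.preimage_inf]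
      exact le_inf hVX (le_inf hVX' (le_inf hVF hVF'))
    have g₁deg : MvPolynomial.X (j y') * (F (i y) * F (i y')) ∈ grading A r (1 + (e + e)) :=
      SetLike.mul_mem_graded (hXdeg _) (SetLike.mul_mem_graded (hF _) (hF _))
    have g₂deg : MvPolynomial.X (j y) * (F (i y) * F (i y')) ∈ grading A r (1 + (e + e)) :=
      SetLike.mul_mem_graded (hXdeg _) (SetLike.mul_mem_graded (hF _) (hF _))
    have g₃deg : MvPolynomial.X (j y) * (MvPolynomial.X (j y') * F (i y')) ∈ grading A r (1 + (1 + e)) :=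
      SetLike.mul_mem_graded (hXdeg _) (SetLike.mul_mem_graded (hXdeg _) (hF _))
    have hx₂ : MvPolynomial.X (j y) * (MvPolynomial.X (j y') * (F (i y) * F (i y'))) =
        MvPolynomial.X (j y') * (MvPolynomial.X (j y) * (F (i y) * F (i y'))) := by ring
    have hx₃ : MvPolynomial.X (j y) * (MvPolynomial.X (j y') * (F (i y) * F (i y'))) =
        F (i y) * (MvPolynomial.X (j y) * (MvPolynomial.X (j y') * F (i y'))) := by ring
    -- every factor as `φ^*` of a fraction over `D₊(P)`
    have eChart : Y.presheaf.map (homOfLE (hy.trans inf_le_right)).op (chartFun φ (j y') (j y)) =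
        φ.appLE _ V hVP (Proj.awayToSection (grading A r) _ (awayMap (grading A r) g₁deg rfl (frac A (j y) (j y')))) := by
      rw [← map_homRatio_eq_map_chartFun φ (j y) (j y') hVX, GeneratingSections.homRatio_eq_appLE,
        res_appLE_awayToSection φ g₁deg rfl _ le_rfl hVX hVP]
    have eLam' : secRes Y (hy'.trans inf_le_right) (lam y') =
        φ.appLE _ V hVP (Proj.awayToSection (grading A r) _ (awayMap (grading A r) g₂deg hx₂
          (Away.mk (grading A r) (hXdeg (j y')) (e * e) (F (i y') ^ e) (hFe y')))) :=
      res_appLE_awayToSection φ g₂deg hx₂ _ (hZop y').le (hy'.trans inf_le_right) hVP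
    have eLam : secRes Y (hy.trans inf_le_right) (lam y) =
        φ.appLE _ V hVP (Proj.awayToSection (grading A r) _ (awayMap (grading A r) g₁deg rfl
          (Away.mk (grading A r) (hXdeg (j y)) (e * e) (F (i y) ^ e) (hFe y)))) :=
      res_appLE_awayToSection φ g₁deg rfl _ (hZop y).le (hy.trans inf_le_right) hVP
    have eg : cY.g y y' V (hy.trans inf_le_left) (hy'.trans inf_le_left) =
        φ.appLE _ V hVP (Proj.awayToSection (grading A r) _ (awayMap (grading A r) g₃deg hx₃
          (GeneratingSections.formRatio (grading A r) (hF (i y)) (hF (i y'))))) := by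
      rw [hg, GeneratingSections.formHomRatio_eq_appLE, secRes, res_appLE_awayToSection φ g₃deg hx₃ _ le_rfl hVF hVP]
    -- the identity of fractions over `D₊(P)`
    have hAway : awayMap (grading A r) g₁deg rfl (frac A (j y) (j y')) ^ (e * e) *
        awayMap (grading A r) g₂deg hx₂ (Away.mk (grading A r) (hXdeg (j y')) (e * e) (F (i y') ^ e) (hFe y')) =
        awayMap (grading A r) g₁deg rfl (Away.mk (grading A r) (hXdeg (j y)) (e * e) (F (i y) ^ e) (hFe y)) *
        awayMap (grading A r) g₃deg hx₃ (GeneratingSections.formRatio (grading A r) (hF (i y)) (hF (i y'))) := by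
      apply val_injective
      simp only [val_mul, val_pow, awayMap_mk, Away.val_mk, GeneratingSections.formRatio, Away.isLocalizationElem, frac,
        Localization.mk_pow, Localization.mk_mul]
      rw [Localization.mk_eq_mk_iff, Localization.r_iff_exists]
      refine ⟨1, ?_⟩
      simp only [OneMemClass.coe_one, one_mul, Submonoid.coe_mul, SubmonoidClass.coe_pow]
      ring
    change G.cocycle.g y' y V _ _ * secRes Y _ (lam y') = secRes Y _ (lam y) * cY.g y y' V _ _
    rw [hGg, eChart, eLam', eLam, eg, ← map_pow, ← map_pow, ← map_mul, ← map_mul, ← map_mul, ← map_mul, hAway]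

end SerreTwist

end Literature.AlgebraicGeometry.Modules

end
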